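import Summits.BirchSwinnertonDyer.Rank1Residual.Additive.SignedTwistRoot
import Summits.BirchSwinnertonDyer.Rank1Residual.Additive.CyclotomicTowerSignedSelmer
import Mathlib.FieldTheory.Galois.Infinite
import HarnessLib

/-!
# (P5-2a) Local Galois bookkeeping of the signed-`η` twist dictionary at an embedding `ι : ℚ̄ → ℚ̄_E`:
# consequences of (D0) — `Gal(ℚ̄_E/ℚ_m·E) = Gal(ℚ̄_E/K₀ℚ_m·E) · Gal(ℚ̄_E/ℚ_∞·E)`, an element over
# `ℚ_∞` with `η = −1` — and `Γ_E`-equivariance of cc-typer-6's pair trace / `Γ_E`-stability of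
# `E^ε(K_{n,v})` (`cells/n1011/skel/T-O7ss-P5.md` §2 (D0)(i)(iii), (D4b))
(cell `b2b-bsdres`, team n1011, seat n1011-p17 GEN 7; row T-O7ss-P13 follow-up (P5), file P5-2a;
designs (A)(B) APPROVED by referee-1 GEN 22)

HONEST FRAMING (cell `b2b-bsdres`, run/shared/lean/b2b/bsd-rank1-residual/, verbatim in every
file): the goal of the cell is to DELETE the COMBINATION-SHAPED residual classes of the
Birch–Swinnerton-Dyer formula for ALL analytic-rank `≤ 1` elliptic curves over `ℚ` — "full BSD
formula for every rank `≤ 1` curve in class `C`" assembled STRICTLY from published theorems — so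
that the rank-`≤ 1` remainder becomes exactly the CONSTRUCTION-SHAPED classes, which are TYPED
(missing-input `Prop`s), NOT attempted. This is not "finishing BSD". Research route on
O7-ss ∩ (G)∧ss ∩ e = 2 (OPEN) / X4 CONSTRUCTION-SHAPED; nothing here is booked; no label moves.
TOOL THEOREMS ONLY: no definition, no named Literature fact, no `sorry`; axioms standard.


RESHAPE vs the skeleton, said loudly: (D0)(i)/(iii) (and every (D4) statement downstream) carry,
besides the unfolded (D0) hypothesis `hD`, the binder `hκ₀ : ∀ x, ∃ g ∈ galRange K₀, κ g = x`
("`κ(Gal(ℚ̄/K₀)) = ℤ_p`", i.e. `K₀ ∩ ℚ_∞ = ℚ`; discharged for `K₀ = ℚ(μ_p)` by cc-typer-6's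
`kappa_surjOn_galRange_cyclotomic`). WITHOUT it (D0)(i) is false (if `K₀ ⊇ ℚ_1` then
`Gal(ℚ̄_E/K₀·E)·Gal(ℚ̄_E/ℚ_∞·E)` misses every `τ` with `κ(res τ) ∈ ℤ_pˣ`). The statements are made
for an arbitrary `ℚ`-embedding `ι` (the skeleton pins `ι = closureEmb E`).

## What is proved
* §4 `exists_resGalOfEmb_mem_galRange_and_kappa_eq`, `exists_mem_localSubgroupOfEmb_tower_inv_mul_mem_ker`,
  **`localSubgroupOfEmb_layer_eq_sup`** ((D0)(i)), `exists_smul_rootInClosure_ne`,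
  **`exists_mem_localSubgroupOfEmb_ker_eta_eq_neg_one`** ((D0)(iii));
* §5b `smul_mem_localFixedPointsOfEmb`, **`localPairTraceOfEmb_smul`** (`Tr_{L₂/L₁}(τ • P) = τ • Tr P`
  for normal `Gal(K̄/Lᵢ)`; conjugation reindexes the cosets), **`smul_mem_towerSignedLocalPointsOfEmb`**
  (`E^ε(K_{n,v})` is `Γ_E`-stable).

References: S. Kobayashi, Invent. Math. 152 (2003) §2 p. 4 [Kobayashi2003].
-/

noncomputable section

open scoped Classical

open WeierstrassCurve Field

namespace Summit.BirchSwinnertonDyer.Rank1Residual.Additive.SignedTwist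

open Literature.NumberTheory.EllipticCurves Literature.NumberTheory.GaloisRepresentations
  Literature.NumberTheory.EllipticCurves.Kobayashi2003
  Summit.BirchSwinnertonDyer.Rank1Residual.AdditivePotMult

/-! ## §4 Consequences of (D0) at an embedding `ι`: layers vs. tower, an `η = −1` element of `(ker κ)_E` -/

section LocalGalois

open ZpExtension

variable {p : ℕ} [Fact p.Prime] (κ : ZpExtension ℚ p) (K₀ : Type) [Field K₀] [NumberField K₀]
  {E : Type} [Field E] [Algebra ℚ E] (ι : AlgebraicClosure ℚ →ₐ[ℚ] AlgebraicClosure E)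

/-- Under (D0) (`res(Γ_E)·Gal(ℚ̄/K₀ℚ_∞) = Γ_ℚ`) and `κ(Gal(ℚ̄/K₀)) = ℤ_p` (`K₀ ∩ ℚ_∞ = ℚ`, e.g.
`kappa_surjOn_galRange_cyclotomic`): every value of `κ` is taken on an element of the decomposition
group lying over `Gal(ℚ̄/K₀)`. [folklore] -/
theorem exists_resGalOfEmb_mem_galRange_and_kappa_eq
    (hD : ∀ g : absoluteGaloisGroup ℚ, ∃ τ : absoluteGaloisGroup E,
      (resGalOfEmb ι τ)⁻¹ * g ∈ towerTopSubgroup κ K₀)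
    (hκ₀ : ∀ x, ∃ g ∈ galRange (K := ℚ) K₀, κ g = x) (x : Multiplicative ℤ_[p]) :
    ∃ u : absoluteGaloisGroup E, resGalOfEmb ι u ∈ galRange (K := ℚ) K₀ ∧ κ (resGalOfEmb ι u) = x := by
  obtain ⟨g, hgK, hgx⟩ := hκ₀ x
  obtain ⟨u, hu⟩ := hD g
  rw [mem_towerTopSubgroup_iff, mem_kerSubgroup] at hu
  have hru : resGalOfEmb ι u = g * ((resGalOfEmb ι u)⁻¹ * g)⁻¹ := by group
  refine ⟨u, ?_, ?_⟩
  · rw [hru]; exact mul_mem hgK (inv_mem hu.2)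
  · rw [hru, map_mul, map_inv, hu.1, inv_one, mul_one, hgx]

/-- **(D0)(i), pointwise**: every `τ ∈ Gal(ℚ̄_E/ℚ_m·E)` is `u · k` with `res u ∈ Gal(ℚ̄/K₀ℚ_m)` and
`res k ∈ Gal(ℚ̄/ℚ_∞)`. [folklore] -/
theorem exists_mem_localSubgroupOfEmb_tower_inv_mul_mem_ker
    (hD : ∀ g : absoluteGaloisGroup ℚ, ∃ τ : absoluteGaloisGroup E,
      (resGalOfEmb ι τ)⁻¹ * g ∈ towerTopSubgroup κ K₀)
    (hκ₀ : ∀ x, ∃ g ∈ galRange (K := ℚ) K₀, κ g = x) {m : ℕ} {τ : absoluteGaloisGroup E}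
    (hτ : τ ∈ localSubgroupOfEmb (κ.layerSubgroup m) ι) :
    ∃ u ∈ localSubgroupOfEmb (towerSubgroup κ K₀ m) ι, u⁻¹ * τ ∈ localSubgroupOfEmb κ.kerSubgroup ι := by
  obtain ⟨u, huK, hux⟩ :=
    exists_resGalOfEmb_mem_galRange_and_kappa_eq κ K₀ ι hD hκ₀ (κ (resGalOfEmb ι τ))
  rw [mem_localSubgroupOfEmb_iff, mem_layerSubgroup] at hτ
  refine ⟨u, ?_, ?_⟩
  · rw [mem_localSubgroupOfEmb_iff, mem_towerSubgroup_iff, mem_layerSubgroup, hux]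
    exact ⟨hτ, huK⟩
  · rw [mem_localSubgroupOfEmb_iff, mem_kerSubgroup, map_mul, map_inv, map_mul, map_inv, hux,
      inv_mul_cancel]

/-- **(D0)(i)**: `Gal(ℚ̄_E/ℚ_m·E) = Gal(ℚ̄_E/K₀ℚ_m·E) ⊔ Gal(ℚ̄_E/ℚ_∞·E)` ("`K₀ℚ_∞·E / ℚ_m·E` is
generated by its two obvious subextensions' groups"). [folklore] -/
theorem localSubgroupOfEmb_layer_eq_sup
    (hD : ∀ g : absoluteGaloisGroup ℚ, ∃ τ : absoluteGaloisGroup E,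
      (resGalOfEmb ι τ)⁻¹ * g ∈ towerTopSubgroup κ K₀)
    (hκ₀ : ∀ x, ∃ g ∈ galRange (K := ℚ) K₀, κ g = x) (m : ℕ) :
    localSubgroupOfEmb (κ.layerSubgroup m) ι =
      localSubgroupOfEmb (towerSubgroup κ K₀ m) ι ⊔ localSubgroupOfEmb κ.kerSubgroup ι := by
  apply le_antisymm
  · intro τ hτ
    obtain ⟨u, hu, hk⟩ := exists_mem_localSubgroupOfEmb_tower_inv_mul_mem_ker κ K₀ ι hD hκ₀ hτ
    have := Subgroup.mul_mem_sup hu hk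
    rwa [mul_inv_cancel_left] at this
  · have h1 : towerSubgroup κ K₀ m ≤ κ.layerSubgroup m := fun σ hσ ↦
      ((mem_towerSubgroup_iff κ K₀ m σ).mp hσ).1
    exact sup_le (Subgroup.comap_mono h1) (Subgroup.comap_mono (κ.kerSubgroup_le_layerSubgroup m))

variable {θ : K₀} {c : ℚ} (hθ : θ ∉ Set.range (algebraMap ℚ K₀)) (hc : θ ^ 2 = algebraMap ℚ K₀ c)
  (η : absoluteGaloisGroup ℚ →* ℤˣ)
  (hη : ∀ σ : absoluteGaloisGroup ℚ, η σ = 1 ↔ σ • rootInClosure K₀ θ = rootInClosure K₀ θ)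

include hθ in
/-- Some `σ ∈ Γ_ℚ` moves `t` (`t ∉ ℚ = ℚ̄^{Γ_ℚ}`). [folklore] -/
theorem exists_smul_rootInClosure_ne : ∃ σ : absoluteGaloisGroup ℚ,
    σ • rootInClosure K₀ θ ≠ rootInClosure K₀ θ := by
  by_contra h
  push Not at h
  -- `ℚ̄/ℚ` is Galois (the instances are keyed on `AlgebraicClosure.instAlgebra`; re-thread them
  -- through the `algebraRat` diamond, all defeq)
  haveI hA : Algebra.IsAlgebraic ℚ (AlgebraicClosure ℚ) := AlgebraicClosure.isAlgebraic ℚ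
  haveI : IsAlgClosure ℚ (AlgebraicClosure ℚ) := ⟨inferInstance, hA⟩
  haveI : Normal ℚ (AlgebraicClosure ℚ) := IsAlgClosure.normal _ _
  haveI : IsGalois ℚ (AlgebraicClosure ℚ) := IsGalois.mk
  apply rootInClosure_not_mem K₀ hθ
  have hbot : rootInClosure K₀ θ ∈ (⊥ : IntermediateField ℚ (AlgebraicClosure ℚ)) :=
    (InfiniteGalois.mem_bot_iff_fixed (rootInClosure K₀ θ)).mpr fun f ↦ h f
  exact IntermediateField.mem_bot.mp hbot

include hθ hc hη in
/-- **(D0)(iii)**: `η ≢ 1` on `Gal(ℚ̄_E/ℚ_∞·E)` — there is `τ` over `ℚ_∞` in the decomposition group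
with `η(res τ) = −1` (so `η ≢ 1` on every `Gal(ℚ̄_E/ℚ_n·E)`): a global `σ` with `σ t = −t`, moved
into the decomposition group modulo `Gal(ℚ̄/K₀ℚ_∞)` by (D0), then into `(ker κ)_E` by (D0)(i).
[folklore] -/
theorem exists_mem_localSubgroupOfEmb_ker_eta_eq_neg_one
    (hD : ∀ g : absoluteGaloisGroup ℚ, ∃ τ : absoluteGaloisGroup E,
      (resGalOfEmb ι τ)⁻¹ * g ∈ towerTopSubgroup κ K₀)
    (hκ₀ : ∀ x, ∃ g ∈ galRange (K := ℚ) K₀, κ g = x) :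
    ∃ τ ∈ localSubgroupOfEmb κ.kerSubgroup ι, η (resGalOfEmb ι τ) = -1 := by
  obtain ⟨σ, hσ⟩ := exists_smul_rootInClosure_ne K₀ hθ
  have hησ : η σ = -1 :=
    (eta_eq_neg_one_iff K₀ hθ hc η hη σ).mpr ((smul_rootInClosure_eq_neg_iff K₀ hθ hc σ).mpr hσ)
  -- into the decomposition group, modulo `Gal(ℚ̄/K₀ℚ_∞)`
  obtain ⟨τ₁, hτ₁⟩ := hD σ
  rw [mem_towerTopSubgroup_iff, mem_kerSubgroup] at hτ₁
  have hη1 : η ((resGalOfEmb ι τ₁)⁻¹ * σ) = 1 := (hη _).mpr (apply_rootInClosure_of_mem K₀ hτ₁.2)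
  have hητ₁ : η (resGalOfEmb ι τ₁) = -1 := by
    rw [map_mul, map_inv, hησ, inv_mul_eq_iff_eq_mul, mul_one] at hη1
    exact hη1.symm
  have hκτ₁ : κ (resGalOfEmb ι τ₁) = κ σ := by
    have h := hτ₁.1
    rwa [map_mul, map_inv, inv_mul_eq_one] at h
  -- into `(ker κ)_E`, by an element over `K₀` with the same `κ`
  obtain ⟨u, huK, hux⟩ := exists_resGalOfEmb_mem_galRange_and_kappa_eq κ K₀ ι hD hκ₀ (κ σ)
  refine ⟨u⁻¹ * τ₁, ?_, ?_⟩
  · rw [mem_localSubgroupOfEmb_iff, mem_kerSubgroup, map_mul, map_inv, map_mul, map_inv, hux,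
      hκτ₁, inv_mul_cancel]
  · rw [map_mul, map_inv, map_mul, map_inv, (hη _).mpr (apply_rootInClosure_of_mem K₀ huK),
      inv_one, one_mul, hητ₁]

end LocalGalois

/-! ## §5b `Γ_E`-equivariance of the pair trace on fixed points; `Γ_E`-stability of `E^ε(K_n)` -/

section PairTraceSmul

universe u

variable {K : Type u} [Field K] {E : Type u} [Field E] [Algebra K E]
  (ι : AlgebraicClosure K →ₐ[K] AlgebraicClosure E) (W : WeierstrassCurve K)

/-- A NORMAL subgroup's fixed points are `Γ_E`-stable: `τ • P ∈ E(L_w)` for `P ∈ E(L_w)` when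
`Gal(K̄/L) ⊴ Γ_K`. [folklore] -/
theorem smul_mem_localFixedPointsOfEmb {H : Subgroup (absoluteGaloisGroup K)} [H.Normal]
    (τ : absoluteGaloisGroup E) {P : localPoints W E} (hP : P ∈ localFixedPointsOfEmb ι W H) :
    τ • P ∈ localFixedPointsOfEmb ι W H := by
  haveI : (localSubgroupOfEmb H ι).Normal := Subgroup.normal_comap _
  rw [mem_localFixedPointsOfEmb_iff] at hP ⊢
  intro u hu
  rw [smul_smul, show u * τ = τ * (τ⁻¹ * u * τ) by group, mul_smul,
    hP _ (Subgroup.Normal.conj_mem' inferInstance u hu τ)]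

/-- **The pair trace commutes with `Γ_E` on `E(L₂,w)`** for NORMAL `Gal(K̄/L₁), Gal(K̄/L₂) ⊴ Γ_K`:
`Tr_{L₂/L₁}(τ • P) = τ • Tr_{L₂/L₁} P` (conjugation by `τ` permutes the cosets; independence of
representatives). [cite: Kobayashi2003, §2 p. 4 (the trace maps)] -/
theorem localPairTraceOfEmb_smul {H₁ H₂ : Subgroup (absoluteGaloisGroup K)} [H₁.Normal] [H₂.Normal]
    [H₂.FiniteIndex] (τ : absoluteGaloisGroup E) {P : localPoints W E}
    (hP : P ∈ localFixedPointsOfEmb ι W H₂) :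
    localPairTraceOfEmb ι W H₁ H₂ (τ • P) = τ • localPairTraceOfEmb ι W H₁ H₂ P := by
  classical
  haveI h1 : (localSubgroupOfEmb H₁ ι).Normal := Subgroup.normal_comap _
  haveI h2 : (localSubgroupOfEmb H₂ ι).Normal := Subgroup.normal_comap _
  set A := localSubgroupOfEmb H₁ ι
  set N := (localSubgroupOfEmb H₂ ι).subgroupOf A
  haveI : Fintype (A ⧸ N) := Fintype.ofFinite _
  let φ : A ≃* A := MulAut.conjNormal (τ⁻¹)
  have hφ : ∀ x : A, ((φ x : A) : absoluteGaloisGroup E) = τ⁻¹ * x * τ := fun x ↦ by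
    change (((MulAut.conjNormal τ⁻¹) x : A) : absoluteGaloisGroup E) = _
    rw [MulAut.conjNormal_apply, inv_inv]
  have hmemN : ∀ z : A, z ∈ N ↔ ((z : A) : absoluteGaloisGroup E) ∈ localSubgroupOfEmb H₂ ι :=
    fun z ↦ Subgroup.mem_subgroupOf
  have hN : N.map φ.toMonoidHom = N := by
    ext x
    rw [Subgroup.mem_map]
    constructor
    · rintro ⟨y, hy, rfl⟩
      rw [hmemN] at hy
      rw [MulEquiv.coe_toMonoidHom, hmemN, hφ]
      exact h2.conj_mem' _ hy τ
    · intro hx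
      rw [hmemN] at hx
      refine ⟨φ.symm x, ?_, φ.apply_symm_apply x⟩
      rw [hmemN]
      change (((MulAut.conjNormal τ⁻¹).symm x : A) : absoluteGaloisGroup E) ∈ localSubgroupOfEmb H₂ ι
      rw [MulAut.conjNormal_symm_apply, inv_inv]
      exact h2.conj_mem _ hx τ
  let f : A ⧸ N ≃* A ⧸ N := QuotientGroup.congr N N φ hN
  have hs : ∀ q : A ⧸ N, (QuotientGroup.mk (φ (f.symm q).out) : A ⧸ N) = q := fun q ↦ by
    rw [← QuotientGroup.congr_mk N N φ hN, QuotientGroup.out_eq', MulEquiv.apply_symm_apply]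
  symm
  rw [localPairTraceOfEmb_apply_eq_sum_of_mem ι W hP _ hs, Finset.smul_sum,
    localPairTraceOfEmb_apply]
  refine Fintype.sum_equiv f.symm.toEquiv _ _ fun q ↦ ?_
  rw [smul_smul, hφ, ← mul_assoc, ← mul_assoc, mul_inv_cancel, one_mul, mul_smul]
  rfl

/-- **`E^ε(K_{n,v})` is `Γ_E`-stable** for a tower of NORMAL subgroups (Kobayashi's `K_n/ℚ` Galois).
[cite: Kobayashi2003, §2 p. 4] -/
theorem smul_mem_towerSignedLocalPointsOfEmb (U : ℕ → Subgroup (absoluteGaloisGroup K))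
    [∀ n, (U n).FiniteIndex] [∀ n, (U n).Normal] (ε : ℤˣ) (n : ℕ) (τ : absoluteGaloisGroup E)
    {S : localPoints W E} (hS : S ∈ towerSignedLocalPointsOfEmb U ι W ε n) :
    τ • S ∈ towerSignedLocalPointsOfEmb U ι W ε n := by
  obtain ⟨hSn, hSm, hS0⟩ := (mem_towerSignedLocalPointsOfEmb_iff U ι W ε n S).mp hS
  refine (mem_towerSignedLocalPointsOfEmb_iff U ι W ε n _).mpr
    ⟨smul_mem_localFixedPointsOfEmb ι W τ hSn, fun m hm hε ↦ ?_, fun hε ↦ ?_⟩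
  · rw [localPairTraceOfEmb_smul ι W τ hSn]
    exact smul_mem_localFixedPointsOfEmb ι W τ (hSm m hm hε)
  · rw [localPairTraceOfEmb_smul ι W τ hSn]
    exact smul_mem_localFixedPointsOfEmb ι W τ (hS0 hε)

end PairTraceSmul

end Summit.BirchSwinnertonDyer.Rank1Residual.Additive.SignedTwist
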